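import Summits.CriticalPhenomena.PercolationContinuityZ3.Theorems.PercNearOneGluingNoHeavyConstsMDLXJointXEdgeInduction
import HarnessLib

/-!
# CROSS at the marker `u = z`: the identity `M₁ = M₀ + M₂ + tw·cov_{D∩Z}(F; s↔y)` between the members

builds on p205010 (kernel theorem, internal audit signed; external expert review pending).  Support file (`--supports
stmt-CriticalPhenomena-4575`); theorems only, no sorries, standard axioms.  Memo `run/shared/lean/prim/consts/FROM-prim-consts-2-g21-GIBBS-ORBIT.md` §3b.

For the nested avoided sets `X ⊂ X' = X ∪ {z}` (the added vertex IS the marker `z`) the polarised margins `P(X₀,X₁,X₂) = Consts.polMargin μ s y z F X₀ X₁ X₂`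
satisfy, for EVERY functional `F` (no monotonicity, no distinctness hypotheses):
* `Consts.polMargin_marker_members_identity` —
  `M₁ = M₀ + M₂ + tw·(μ(D∩Z)·∫_{D∩Y∩Z} F − μ(D∩Y∩Z)·∫_{D∩Z} F)`,
  where `M₀ = P(X,X,X)` (the MDL(X)′ margin), `M₁ = P(X',X,X)+P(X,X',X)+P(X,X,X')`, `M₂ = P(X',X',X)+P(X',X,X')+P(X,X',X')` (the two CROSS members of
  `Consts.CrossRel` at `u = z`), `D = {s ↮ X}`, `Y = {s↔y}`, `Z = {s↔z}`, `tw = μ({y ↮ {s}∪X} ∩ D ∩ {y↔z})`; the last bracket is the unnormalised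
  covariance of `F(C_s)` and `1{s↔y}` INSIDE `D ∩ {s↔z}`.  (Bracket form behind it: with `t' = μ({y↮{s,z}∪X} ∩ {s↮X∪{z}})`, `D' = D ∖ Z`,
  `M₀ = t·cov_D(F;Z) − tw·cov_D(F;Y)`, `M₂ = t'·cov_D(F;Z) − tw·cov_{D'}(F;Y)`, `M₁ = (t+t')·cov_D(F;Z) − tw·[cov_D(F;Y) + cov_{D'}(F;Y) − cov_{D∩Z}(F;Y)]`.)
* `Consts.crossRel_marker_M1_of_M2` — hence `M₀ ≥ 0`, `M₂ ≥ 0` and `cov_{D∩Z}(F; s↔y) ≥ 0` give `M₁ ≥ 0`.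
EVIDENCE / context (seat prim-consts-2 gen 21, exact arithmetic, min over all up-sets of the edge-cluster poset, n ≤ 7): `cov_{D∩Z}(U;Y)` is NOT signed
(conditioning on `{s↔z}` breaks positive association), but `M₁ − M₀ = M₂ + tw·cov_{D∩Z} ≥ 0` and `M₁ − M₂ = M₀ + tw·cov_{D∩Z} ≥ 0` held in 350/350 weighted
graphs: at `u = z` the member `M₁` dominates both `M₀` and `M₂`.
-/

noncomputable section

namespace Summit.CriticalPhenomena.PercolationContinuityZ3.Theorems

open MeasureTheory Set Literature.Probability.LatticeModels Literature.Probability.Percolation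
open scoped Classical

namespace Consts

variable {V : Type*} [Fintype V]

/-- **`M₁ = M₀ + M₂ + tw·cov_{D∩Z}(F; s↔y)` at the marker `u = z`** (all functionals `F`; pure bookkeeping: `D_{X∪z} = D ∖ Z`, `D_{X∪z} ∩ Z = ∅`,
`{y ↮ {s,z}∪X} ∩ {y↔z} = ∅`). [cite: VandenbergHaggstromKahn2005, §2.1 (pp. 9–13)] -/
theorem polMargin_marker_members_identity (μ : Measure (BondConfig V)) [IsFiniteMeasure μ] (s y z : V) (X : Set V)
    (F : Set (Sym2 V) → ℝ) :
    polMargin μ s y z F (insert z X) X X + polMargin μ s y z F X (insert z X) X + polMargin μ s y z F X X (insert z X) =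
      polMargin μ s y z F X X X +
        (polMargin μ s y z F (insert z X) (insert z X) X + polMargin μ s y z F (insert z X) X (insert z X) +
          polMargin μ s y z F X (insert z X) (insert z X)) +
        μ.real ({ω : BondConfig V | ∀ x ∈ insert s X, ¬ (openGraph ω).Reachable y x} ∩
            {ω | ∀ x ∈ X, ¬ (openGraph ω).Reachable s x} ∩ openConn y z) *
          (μ.real ({ω : BondConfig V | ∀ x ∈ X, ¬ (openGraph ω).Reachable s x} ∩ openConn s z) *
              (∫ ω in {ω : BondConfig V | ∀ x ∈ X, ¬ (openGraph ω).Reachable s x} ∩ openConn s y ∩ openConn s z,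
                F (openEdgeCluster ω s) ∂μ) -
            μ.real ({ω : BondConfig V | ∀ x ∈ X, ¬ (openGraph ω).Reachable s x} ∩ openConn s y ∩ openConn s z) *
              (∫ ω in {ω : BondConfig V | ∀ x ∈ X, ¬ (openGraph ω).Reachable s x} ∩ openConn s z,
                F (openEdgeCluster ω s) ∂μ)) := by
  set D : Set (BondConfig V) := {ω | ∀ x ∈ X, ¬ (openGraph ω).Reachable s x} with hD
  set D' : Set (BondConfig V) := {ω | ∀ x ∈ insert z X, ¬ (openGraph ω).Reachable s x} with hD'
  set A : Set (BondConfig V) := {ω | ∀ x ∈ insert s X, ¬ (openGraph ω).Reachable y x} with hA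
  set A' : Set (BondConfig V) := {ω | ∀ x ∈ insert s (insert z X), ¬ (openGraph ω).Reachable y x} with hA'
  set Y : Set (BondConfig V) := openConn s y with hY
  set Z : Set (BondConfig V) := openConn s z with hZ
  -- set identities
  have hD'eq : D' = D \ Z := by
    ext ω
    simp only [hD', hD, hZ, Set.mem_setOf_eq, Set.forall_mem_insert, Set.mem_sdiff, openConn]
    tauto
  have hD'Z : D' ∩ Z = ∅ := by
    rw [hD'eq]; exact Set.sdiff_inter_self
  have hD'Y : D' ∩ Y = (D ∩ Y) \ Z := by
    rw [hD'eq, Set.inter_sdiff_right_comm]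
  have hA'W : A' ∩ D' ∩ openConn y z = ∅ := by
    ext ω
    simp only [hA', Set.mem_inter_iff, Set.mem_setOf_eq, Set.mem_empty_iff_false, iff_false, not_and, openConn]
    intro h hyz
    exact h.1 z (Set.mem_insert_of_mem s (Set.mem_insert z X)) hyz
  -- base quantities
  set t := μ.real (A ∩ D) with ht
  set tw := μ.real (A ∩ D ∩ openConn y z) with htw
  set t' := μ.real (A' ∩ D') with ht'
  set d := μ.real D with hd
  set dy := μ.real (D ∩ Y) with hdy
  set dz := μ.real (D ∩ Z) with hdz
  set dyz := μ.real (D ∩ Y ∩ Z) with hdyz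
  set f := ∫ ω in D, F (openEdgeCluster ω s) ∂μ with hf
  set fy := ∫ ω in D ∩ Y, F (openEdgeCluster ω s) ∂μ with hfy
  set fz := ∫ ω in D ∩ Z, F (openEdgeCluster ω s) ∂μ with hfz
  set fyz := ∫ ω in D ∩ Y ∩ Z, F (openEdgeCluster ω s) ∂μ with hfyz
  have hmeas : ∀ U : Set (BondConfig V), MeasurableSet U := fun _ => MeasurableSet.of_discrete
  have hint : ∀ S : Set (BondConfig V), IntegrableOn (fun ω => F (openEdgeCluster ω s)) S μ := fun S =>
    (Integrable.of_finite (f := fun ω => F (openEdgeCluster ω s))).integrableOn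
  -- the primed quantities in terms of the base ones
  have e_d' : μ.real D' = d - dz := by
    have h := measureReal_inter_add_sdiff (μ := μ) (s := D) (hmeas Z)
    rw [hD'eq]; linarith
  have e_f' : ∫ ω in D', F (openEdgeCluster ω s) ∂μ = f - fz := by
    have h := integral_inter_add_sdiff (μ := μ) (s := D) (hmeas Z) (hint D)
    rw [hD'eq]; linarith
  have e_dz' : μ.real (D' ∩ Z) = 0 := by rw [hD'Z, measureReal_empty]
  have e_fz' : ∫ ω in D' ∩ Z, F (openEdgeCluster ω s) ∂μ = 0 := by rw [hD'Z, Measure.restrict_empty, integral_zero_measure]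
  have e_dy' : μ.real (D' ∩ Y) = dy - dyz := by
    have h := measureReal_inter_add_sdiff (μ := μ) (s := D ∩ Y) (hmeas Z)
    rw [hD'Y]; linarith
  have e_fy' : ∫ ω in D' ∩ Y, F (openEdgeCluster ω s) ∂μ = fy - fyz := by
    have h := integral_inter_add_sdiff (μ := μ) (s := D ∩ Y) (hmeas Z) (hint (D ∩ Y))
    rw [hD'Y]; linarith
  have e_tw' : μ.real (A' ∩ D' ∩ openConn y z) = 0 := by rw [hA'W, measureReal_empty]
  unfold polMargin
  simp only [← hD, ← hD', ← hA, ← hA', ← hY, ← hZ]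
  simp only [e_d', e_f', e_dz', e_fz', e_dy', e_fy', e_tw', ← ht, ← htw, ← ht', ← hd, ← hdy, ← hdz, ← hf, ← hfy, ← hfz]
  ring

/-- **`M₁ ≥ 0` from `M₀ ≥ 0`, `M₂ ≥ 0` and `cov_{D∩Z}(F; s↔y) ≥ 0`** at the marker `u = z` (a corollary of the identity).
[cite: VandenbergHaggstromKahn2005, §2.1 (pp. 9–13)] -/
theorem crossRel_marker_M1_of_M2 (μ : Measure (BondConfig V)) [IsFiniteMeasure μ] (s y z : V) (X : Set V)
    (F : Set (Sym2 V) → ℝ) (hM0 : 0 ≤ polMargin μ s y z F X X X)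
    (hM2 : 0 ≤ polMargin μ s y z F (insert z X) (insert z X) X + polMargin μ s y z F (insert z X) X (insert z X) +
      polMargin μ s y z F X (insert z X) (insert z X))
    (hcov : 0 ≤ μ.real ({ω : BondConfig V | ∀ x ∈ X, ¬ (openGraph ω).Reachable s x} ∩ openConn s z) *
        (∫ ω in {ω : BondConfig V | ∀ x ∈ X, ¬ (openGraph ω).Reachable s x} ∩ openConn s y ∩ openConn s z,
          F (openEdgeCluster ω s) ∂μ) -
      μ.real ({ω : BondConfig V | ∀ x ∈ X, ¬ (openGraph ω).Reachable s x} ∩ openConn s y ∩ openConn s z) *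
        (∫ ω in {ω : BondConfig V | ∀ x ∈ X, ¬ (openGraph ω).Reachable s x} ∩ openConn s z, F (openEdgeCluster ω s) ∂μ)) :
    0 ≤ polMargin μ s y z F (insert z X) X X + polMargin μ s y z F X (insert z X) X + polMargin μ s y z F X X (insert z X) := by
  rw [polMargin_marker_members_identity]
  have htw : 0 ≤ μ.real ({ω : BondConfig V | ∀ x ∈ insert s X, ¬ (openGraph ω).Reachable y x} ∩
      {ω | ∀ x ∈ X, ¬ (openGraph ω).Reachable s x} ∩ openConn y z) := measureReal_nonneg
  have := mul_nonneg htw hcov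
  linarith

end Consts

end Summit.CriticalPhenomena.PercolationContinuityZ3.Theorems
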